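import Summits.ResolutionOfSingularities.ResolutionOfSingularities.Theorems.PurelyInseparableDim4ResConeThreeWeights
import Summits.ResolutionOfSingularities.ResolutionOfSingularities.Theorems.PurelyInseparableDim4ResConeKeepBudget
import HarnessLib
import HarnessLib.Audit.Tags

/-!
# Purely inseparable four-folds — RECURRENCE in the shade-`3` weight automaton at `p = 5`: in the B∞ branch both P-states
# (`|r| = 3`) and Q-states (`|r| = 4`) occur beyond every index (cell `res-dim4-pi`, K2(p) lane, slice C at `(5,3)`; holder brick W′)

[OURS · counted 0 · cell `res-dim4-pi` · K2(p) lane holder res-dim4-p-12 g4 (memo §17, complement of brick W p700619).]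
Nothing here proves K2(5) (`RidgeBudget.NoAboveFloorTrap 5 5`), `NoIsolatedTrap 5 5` or resolution of singularities in
dimension ≥ 4 / characteristic `p` — NOT proved.  AI kernel work, weaker than expert review.

Brick W (`…ResConeThreeWeights`) splits a constant-shade-`3` tail at `p = 5` into the LIGHT branch `(1,1,1)` and the B∞ branch
(one weight-`2` letter for ever; P = `(2,1)`, Q = `(2,1,1)`), FT-free.  This file adds the two RECURRENCES of the B∞ branch:
* `frequently_degree_three` — P-states occur beyond every index (W's `no_three_tail_of_degree_three_budget` with budget `0`
  on a shifted tail; FT-free: a Q-run for ever sits in the upper band `o ≡ 7`);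
* **`exists_degree_four`** — Q-states occur beyond every index (uses FT through `no_tail_of_eventually_free`: a P-run for ever
  hits the previous newborn letter at every step).
So a B∞ tail alternates between P and Q for ever; the Φ-line's KEEP budget (finitely many P-states after the first Q-state)
is what contradicts this — see the holder's HOME skeleton `BInf-ASSEMBLY-SKELETON.lean` (memo §17 (R4)).

[cite: CossartJannsenSaito2020, Thm. 3.14] [cite: HauserPerlega2019PRIMS, §2 (transform D′ of D)]
bears_on: LADDER-RESOLUTION:D157-DOOR2 (res-dim4-pi · K2(p) · slice C `(5,3)` weights, recurrence).  Supports
stmt-ResolutionOfSingularities-16155 (helper).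
-/

set_option linter.dupNamespace false -- mandated namespace of this single-conjunct summit

noncomputable section

namespace Summit.ResolutionOfSingularities.ResolutionOfSingularities.Theorems.PIDim4

namespace ResCone

open MvPolynomial Finset
open Literature.AlgebraicGeometry.Resolution
open Literature.AlgebraicGeometry.Resolution.CentreBlowup
open Literature.AlgebraicGeometry.Resolution.Hauser2010
open Literature.AlgebraicGeometry.Resolution.HauserPerlega2019

variable {K : Type} [Field K] [CharP K 5] [DecidableEq K]

/-- **P-STATES RECUR** (any branch): along a witnessed isolated above-floor `Step0 5` chain with `x^{r₀} ∣ F₀` and constant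
shade `3` from `k₀`, beyond every index `n ≥ k₀` there is a state with `|r_k| = 3` (`o_k = 6`): otherwise `|r_k| = 4` from `n`
on (W's `degree_le_four`), an upper-band run. [OURS] [cite: CossartJannsenSaito2020, Thm. 3.14] -/
theorem frequently_degree_three {c : ℕ → State K} {j : ℕ → Fin 4} {b : ℕ → Fin 4 → K}
    (hc : ∀ k, IsIsolated 5 (c k).F ∧ Step0 5 (c k) (c (k + 1))) (hw : FreeTail.IsWitnessedChain 5 c j b)
    (hr0 : ∀ e ∈ (c 0).F.support, (c 0).r ≤ e) (hfloor : ∀ k, ordZero (c k).F ≠ 5) {k₀ : ℕ}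
    (hshade : ∀ k, k₀ ≤ k → (c k).shade = ((3 : ℕ) : ℕ∞)) (n : ℕ) (hn : k₀ ≤ n) :
    ∃ k, n ≤ k ∧ (c k).r.degree = 3 := by
  classical
  by_contra hno
  push Not at hno
  refine no_three_tail_of_degree_three_budget hc hw hr0 hfloor hshade (k₁ := n) hn (B := 0) fun m => ?_
  rw [Nat.le_zero, Finset.card_eq_zero, Finset.filter_eq_empty_iff]
  intro i _
  exact hno (n + i) (Nat.le_add_right n i)

/-- **Q-STATES RECUR in the B∞ branch**: along a witnessed isolated above-floor `Step0 5` chain with `x^{r₀} ∣ F₀` and constant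
shade `3` from `k₀`, if every state from `k₁` on carries a weight-`2` letter then beyond every index there is a state with
`|r_k| = 4` (a Q-state `(2,1,1)`).  Otherwise the tail is P = `(2,1)` for ever: the heavy letter is kept, the newborn letter
weighs `1`, and the NEXT step must hit it (three letters of weights `2,1,1` would make `|r| = 4`) — a free tail, excluded by FT
(`no_tail_of_eventually_free`, res-dim4-p-5 g3's dock over `FreeTailProof.noIsolatedFreeTailAt_self`). [OURS]
[cite: CossartJannsenSaito2020, Thm. 3.14] -/
theorem exists_degree_four {c : ℕ → State K} {j : ℕ → Fin 4} {b : ℕ → Fin 4 → K}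
    (hc : ∀ k, IsIsolated 5 (c k).F ∧ Step0 5 (c k) (c (k + 1))) (hw : FreeTail.IsWitnessedChain 5 c j b)
    (hr0 : ∀ e ∈ (c 0).F.support, (c 0).r ≤ e) (hfloor : ∀ k, ordZero (c k).F ≠ 5) {k₀ : ℕ}
    (hshade : ∀ k, k₀ ≤ k → (c k).shade = ((3 : ℕ) : ℕ∞)) {k₁ : ℕ} (hk₁ : k₀ ≤ k₁)
    (hheavy : ∀ k, k₁ ≤ k → ∃ W, (c k).r W = 2) (n : ℕ) (hn : k₁ ≤ n) :
    ∃ k, n ≤ k ∧ (c k).r.degree = 4 := by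
  haveI : Fact (Nat.Prime 5) := ⟨by norm_num⟩
  by_contra hno
  push Not at hno
  obtain ⟨-, hlaw, hbj, hfl, hpair⟩ := three_weights_laws hc hw hr0 hfloor hshade
  -- every state from `n` on is a P-state
  have h3 : ∀ k, n ≤ k → (c k).r.degree = 3 := fun k hk => by
    have := degree_le_four hlaw hbj hfl hpair (k := k) (by omega)
    have := hfl k (by omega); have := hno k hk; omega
  -- hence every step from `n + 1` on hits the previous newborn: a free tail
  refine no_tail_of_eventually_free 5 hc hw (k₁ := n) fun k hk => ?_
  obtain ⟨W, hW⟩ := hheavy (k + 1) (by omega)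
  -- at `k+1` (a P-state) the heavy letter `W` is kept and the newborn `j (k+1)` has weight 1; the old newborn `j k` (weight 1 at
  -- `k+1`) must be hit, since the child `k+2` is again a P-state (degree 3 = 2 + 1: only `W` and the newborn survive)
  have hP := (bInf_pattern hc hw hr0 hfloor hshade (k := k + 1) (by omega) hW).1 (h3 (k + 1) (by omega))
  obtain ⟨hjW, hbW, hW', hnew⟩ := hP
  by_contra hfree
  push Not at hfree
  obtain ⟨hjj, hbb⟩ := hfree
  -- `j k` is kept at step `k+1` with its weight
  have hold : (c (k + 1 + 1)).r (j k) = (c (k + 1)).r (j k) :=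
    law_apply_kept (r := fun k => (c k).r) (hlaw (k + 1) (by omega)) hjj hbb
  have hjk1 : (c (k + 1)).r (j k) = 1 := by
    have h := law_apply_self (r := fun k => (c k).r) (hlaw k (by omega))
    have h3k := h3 k hk
    simp only [h3k] at h
    exact h
  -- three distinct letters `W`, `j (k+1)`, `j k` of weights 2, 1, 1 at `k+2`: degree ≥ 4
  have hWj : j k ≠ W := by
    intro hh
    rw [hh] at hjk1
    omega
  have hdeg := apply_add_apply_add_apply_le_degree (c (k + 1 + 1)).r (a := W) (b := j (k + 1)) (c := j k)
    (Ne.symm hjW) (Ne.symm hWj) hjj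
  rw [hW', hnew, hold, hjk1, h3 (k + 1 + 1) (by omega)] at hdeg
  omega

end ResCone

end Summit.ResolutionOfSingularities.ResolutionOfSingularities.Theorems.PIDim4

end
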